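/-
Copyright (c) 2026 the pub-hodgecm-mathlib formalisation cell (harness21).  Prover seat hodgecm-mathlib-K2E5-p17 (g3) (free E5 hand), Track B «K2-LIT»,
#184♮ = hLiu418 = `stmt-HodgeConjecture-24832`; K2E5-plan (g5) DEAL 2026-09-04T05:14:45Z «#33b (a) BIG-CELL OPEN EMBEDDING», file (A′):
the main-orbit block algebra over a COMMUTATIVE RING WITH INVOLUTION (the local rings `L_v = Π_{w∣v} L_w`, split places included).
-/
import Summits.HodgeConjecture.HodgeConjecture.Theorems.K2LiuDoublingMainOrbitBlocksUnit   -- ★ file (A) (p857583): the `M`-calculus (§1 is ring-general)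
import HarnessLib

/-!
# Crux `HLiu418`, road `K2_Liu`, socket #33b organ (a), file (A′): the main orbit over a commutative ring with involution

Cell `hodgecm-mathlib`, crux item hLiu418 = `stmt-HodgeConjecture-24832`; dealer K2E5-plan (g5), LEAD F0P6-plan (g11), consumer K2E2-p12 (g3).
THEOREMS ONLY; lane `--supports stmt-HodgeConjecture-24832 --as helper` (count-neutral).

WHY.  File (A) §2 (★ p857583) is stated over a FIELD with endomorphism `c` (H4a's frame).  The local carrier of the tree, ★ `UnitaryGroup.«local» L c N J v`,
is a matrix group over the PRODUCT ring `L_v = Π_{w ∣ v} L_w` with the involution ★ `conjLocal` — a field only when `v` is inert; at a SPLIT place the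
involution swaps the two factors.  This file re-runs §2 over an arbitrary commutative ring `R` with a ring endomorphism `c`, all invertibility
hypotheses as `IsUnit`, so that file (B) (the open embedding `P_{Δ,v} × G_v → H_v`) applies at every finite place uniformly.
* §1 ring-general sesquilinear bookkeeping (H4a's four lemmas, verbatim proofs over `R`);
* §2 `unitary_mainOrbitBlock_ring`, `isUnit_of_unitary_ring`, `isUnit_mainOrbitBlock_ring`, `siegel_of_mainOrbit_block_ring`,
  **`exists_siegel_mul_iota_iff_isUnit_ring`**, **`siegel_mul_iota_unique_ring`** — same statements as (A) §2 with `[CommRing R]`.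
[GelbartPiatetskishapiroRallis1987, Part A §1] [Liu2021, §B.3 (B.5), Lem. B.11] [HarrisKudlaSweet1996, §1].
HONEST LABEL.  Count-neutral helper; `HC_CM` is proved only modulo the 7 printed citations (2 remaining named inputs: hLiu418 =
`stmt-HodgeConjecture-24832`, h413 = `stmt-HodgeConjecture-24833`) until rung 0 closes.
-/

set_option autoImplicit false
set_option linter.dupNamespace false -- the mandated namespace repeats `HodgeConjecture.HodgeConjecture`

namespace Summit.HodgeConjecture.HodgeConjecture.Cruxes.HLiu418.K2LiuDoublingMainOrbitBlocksRing

open Matrix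
open Summit.HodgeConjecture.HodgeConjecture.Cruxes.HLiu418.K2LiuDoublingMainOrbitBlocksUnit

variable {R : Type*} [CommRing R] (c : R →+* R) {ι : Type*} [Fintype ι]

/-! ## §1 Sesquilinear bookkeeping over a commutative ring -/

/-- `⟪B w, B w′⟫_H = ⟪w, (ᵗ(c B) H B) w′⟫` over a commutative ring. [folklore] -/
theorem conj_mulVec_dotProduct_mulVec_ring {m : Type*} [Fintype m] (B H : Matrix m m R) (w w' : m → R) :
    (⇑c ∘ (B *ᵥ w)) ⬝ᵥ (H *ᵥ (B *ᵥ w')) = (⇑c ∘ w) ⬝ᵥ (((B.map c)ᵀ * H * B) *ᵥ w') := by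
  have h1 : (⇑c ∘ (B *ᵥ w)) = B.map c *ᵥ (⇑c ∘ w) := by
    funext i
    exact RingHom.map_mulVec c B w i
  rw [h1]
  symm
  rw [Matrix.mul_assoc, ← mulVec_mulVec, ← mulVec_mulVec, dotProduct_mulVec, vecMul_transpose]

/-- The doubled form on pairs over a commutative ring: `⟪(u₁,u₂), (v₁,v₂)⟫_{J ⊕ −J} = ⟪u₁, v₁⟫_J − ⟪u₂, v₂⟫_J`. [cite: Liu2021, §B.3 p. 101] -/
theorem doubled_form_sumElim_ring (J : Matrix ι ι R) (u₁ u₂ v₁ v₂ : ι → R) :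
    (⇑c ∘ Sum.elim u₁ u₂) ⬝ᵥ (Matrix.fromBlocks J 0 0 (-J) *ᵥ Sum.elim v₁ v₂) =
      (⇑c ∘ u₁) ⬝ᵥ (J *ᵥ v₁) - (⇑c ∘ u₂) ⬝ᵥ (J *ᵥ v₂) := by
  have hc : (⇑c ∘ Sum.elim u₁ u₂) = Sum.elim (⇑c ∘ u₁) (⇑c ∘ u₂) := by
    funext i; cases i <;> rfl
  rw [hc, fromBlocks_mulVec, Sum.elim_comp_inl, Sum.elim_comp_inr, sumElim_dotProduct_sumElim, zero_mulVec, zero_mulVec, add_zero, zero_add,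
    neg_mulVec, dotProduct_neg, sub_eq_add_neg]

/-- `B (u₁, u₂) = (B₁₁ u₁ + B₁₂ u₂, B₂₁ u₁ + B₂₂ u₂)` over a commutative ring. [folklore] -/
theorem mulVec_sumElim_ring (B : Matrix (ι ⊕ ι) (ι ⊕ ι) R) (u₁ u₂ : ι → R) :
    B *ᵥ Sum.elim u₁ u₂ = Sum.elim (B.toBlocks₁₁ *ᵥ u₁ + B.toBlocks₁₂ *ᵥ u₂) (B.toBlocks₂₁ *ᵥ u₁ + B.toBlocks₂₂ *ᵥ u₂) := by
  conv_lhs => rw [← fromBlocks_toBlocks B]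
  rw [fromBlocks_mulVec, Sum.elim_comp_inl, Sum.elim_comp_inr]

variable [DecidableEq ι]

/-- `(∀ y y′, ⟪A y, A y′⟫_J = ⟪y, y′⟫_J) ⟹ ᵗ(c A) J A = J` over a commutative ring (test on `Pi.single`). [folklore] -/
theorem conjTranspose_mul_mul_eq_of_forall_ring (J A : Matrix ι ι R)
    (h : ∀ y y' : ι → R, (⇑c ∘ (A *ᵥ y)) ⬝ᵥ (J *ᵥ (A *ᵥ y')) = (⇑c ∘ y) ⬝ᵥ (J *ᵥ y')) :
    (A.map c)ᵀ * J * A = J := by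
  ext i j
  have hij := h (Pi.single i 1) (Pi.single j 1)
  rw [conj_mulVec_dotProduct_mulVec_ring] at hij
  have hci : (⇑c ∘ (Pi.single i (1 : R) : ι → R)) = Pi.single i 1 := by
    funext k
    by_cases hk : k = i
    · subst hk; simp
    · simp [hk]
  rw [hci, mulVec_single_one, mulVec_single_one, single_one_dotProduct, single_one_dotProduct] at hij
  exact hij

/-! ## §2 The main orbit over a commutative ring with involution -/

/-- **`A(B) = M(B)⁻¹(B₁₁ − B₂₁)` is `J`-unitary** for an isometry `B` of `J ⊕ −J` over a commutative ring with `M(B)` a unit.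
[cite: GelbartPiatetskishapiroRallis1987, Part A §1] [cite: Liu2021, §B.3 (B.5) p. 101] -/
theorem unitary_mainOrbitBlock_ring (J : Matrix ι ι R) (B : Matrix (ι ⊕ ι) (ι ⊕ ι) R)
    (hB : (B.map c)ᵀ * Matrix.fromBlocks J 0 0 (-J) * B = Matrix.fromBlocks J 0 0 (-J)) (hM : IsUnit (B.toBlocks₂₂ - B.toBlocks₁₂)) :
    (((B.toBlocks₂₂ - B.toBlocks₁₂)⁻¹ * (B.toBlocks₁₁ - B.toBlocks₂₁)).map c)ᵀ * J *
        ((B.toBlocks₂₂ - B.toBlocks₁₂)⁻¹ * (B.toBlocks₁₁ - B.toBlocks₂₁)) = J := by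
  have hMdet : IsUnit (B.toBlocks₂₂ - B.toBlocks₁₂).det := (isUnit_iff_isUnit_det _).1 hM
  have key : ∀ u₁ u₂ : ι → R, B.toBlocks₁₁ *ᵥ u₁ + B.toBlocks₁₂ *ᵥ u₂ = B.toBlocks₂₁ *ᵥ u₁ + B.toBlocks₂₂ *ᵥ u₂ →
      ∀ v₁ v₂ : ι → R, B.toBlocks₁₁ *ᵥ v₁ + B.toBlocks₁₂ *ᵥ v₂ = B.toBlocks₂₁ *ᵥ v₁ + B.toBlocks₂₂ *ᵥ v₂ →
      (⇑c ∘ u₁) ⬝ᵥ (J *ᵥ v₁) - (⇑c ∘ u₂) ⬝ᵥ (J *ᵥ v₂) = 0 := by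
    intro u₁ u₂ hu v₁ v₂ hv
    have h1 : (⇑c ∘ (B *ᵥ Sum.elim u₁ u₂)) ⬝ᵥ (Matrix.fromBlocks J 0 0 (-J) *ᵥ (B *ᵥ Sum.elim v₁ v₂)) =
        (⇑c ∘ Sum.elim u₁ u₂) ⬝ᵥ (Matrix.fromBlocks J 0 0 (-J) *ᵥ Sum.elim v₁ v₂) := by
      rw [conj_mulVec_dotProduct_mulVec_ring, hB]
    rw [mulVec_sumElim_ring, mulVec_sumElim_ring, hu, hv] at h1
    have hdiag : ∀ x y : ι → R, (⇑c ∘ Sum.elim x x) ⬝ᵥ (Matrix.fromBlocks J 0 0 (-J) *ᵥ Sum.elim y y) = 0 := fun x y => by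
      rw [doubled_form_sumElim_ring, sub_self]
    rw [hdiag, doubled_form_sumElim_ring] at h1
    exact h1.symm
  have hgraph : ∀ y : ι → R,
      B.toBlocks₁₁ *ᵥ y + B.toBlocks₁₂ *ᵥ (((B.toBlocks₂₂ - B.toBlocks₁₂)⁻¹ * (B.toBlocks₁₁ - B.toBlocks₂₁)) *ᵥ y) =
        B.toBlocks₂₁ *ᵥ y + B.toBlocks₂₂ *ᵥ (((B.toBlocks₂₂ - B.toBlocks₁₂)⁻¹ * (B.toBlocks₁₁ - B.toBlocks₂₁)) *ᵥ y) := by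
    intro y
    rw [← sub_eq_zero]
    have h2 : B.toBlocks₁₁ *ᵥ y + B.toBlocks₁₂ *ᵥ (((B.toBlocks₂₂ - B.toBlocks₁₂)⁻¹ * (B.toBlocks₁₁ - B.toBlocks₂₁)) *ᵥ y) -
        (B.toBlocks₂₁ *ᵥ y + B.toBlocks₂₂ *ᵥ (((B.toBlocks₂₂ - B.toBlocks₁₂)⁻¹ * (B.toBlocks₁₁ - B.toBlocks₂₁)) *ᵥ y)) =
        (B.toBlocks₁₁ - B.toBlocks₂₁) *ᵥ y -
          (B.toBlocks₂₂ - B.toBlocks₁₂) *ᵥ (((B.toBlocks₂₂ - B.toBlocks₁₂)⁻¹ * (B.toBlocks₁₁ - B.toBlocks₂₁)) *ᵥ y) := by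
      rw [sub_mulVec, sub_mulVec]
      abel
    rw [h2, mulVec_mulVec, ← Matrix.mul_assoc, mul_nonsing_inv _ hMdet, Matrix.one_mul, sub_self]
  exact conjTranspose_mul_mul_eq_of_forall_ring c J _ fun y y' => by
    have h3 := key y _ (hgraph y) y' _ (hgraph y')
    rw [sub_eq_zero] at h3
    exact h3.symm

omit [DecidableEq ι] in
/-- A `J`-unitary matrix is invertible when `det J` is a unit (commutative ring). [folklore] -/
theorem isUnit_of_unitary_ring {J A : Matrix ι ι R} [DecidableEq ι] (hJ : IsUnit J.det) (hA : (A.map c)ᵀ * J * A = J) : IsUnit A := by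
  rw [isUnit_iff_isUnit_det]
  have h := congrArg Matrix.det hA
  rw [det_mul, det_mul, det_transpose] at h
  have h2 : (A.map c).det * A.det * J.det = 1 * J.det := by rw [mul_right_comm, h, one_mul]
  have h3 : (A.map c).det * A.det = 1 := hJ.mul_left_injective h2
  exact isUnit_iff_exists_inv'.2 ⟨(A.map c).det, h3⟩

/-- **`A(B)` is invertible** over a commutative ring (`det J` a unit). [cite: Liu2021, Lem. B.11 p. 102] -/
theorem isUnit_mainOrbitBlock_ring {J : Matrix ι ι R} (hJ : IsUnit J.det) (B : Matrix (ι ⊕ ι) (ι ⊕ ι) R)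
    (hB : (B.map c)ᵀ * Matrix.fromBlocks J 0 0 (-J) * B = Matrix.fromBlocks J 0 0 (-J)) (hM : IsUnit (B.toBlocks₂₂ - B.toBlocks₁₂)) :
    IsUnit ((B.toBlocks₂₂ - B.toBlocks₁₂)⁻¹ * (B.toBlocks₁₁ - B.toBlocks₂₁)) :=
  isUnit_of_unitary_ring c hJ (unitary_mainOrbitBlock_ring c J B hB hM)

omit [DecidableEq ι] in
/-- The Siegel condition for `B · ι(A⁻¹, 1)` over a commutative ring (H4a's `siegel_of_mainOrbit_block`, same proof). [cite: Liu2021, Lem. B.11 p. 102] -/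
theorem siegel_of_mainOrbit_block_ring [DecidableEq ι] (B : Matrix (ι ⊕ ι) (ι ⊕ ι) R) {A : Matrix ι ι R} (hA : IsUnit A)
    (hBA : B.toBlocks₁₁ - B.toBlocks₂₁ = (B.toBlocks₂₂ - B.toBlocks₁₂) * A) :
    (B * Matrix.fromBlocks A⁻¹ 0 0 1).toBlocks₁₁ + (B * Matrix.fromBlocks A⁻¹ 0 0 1).toBlocks₁₂ =
      (B * Matrix.fromBlocks A⁻¹ 0 0 1).toBlocks₂₁ + (B * Matrix.fromBlocks A⁻¹ 0 0 1).toBlocks₂₂ := by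
  have hAdet : IsUnit A.det := (isUnit_iff_isUnit_det A).1 hA
  conv_lhs => rw [← fromBlocks_toBlocks B]
  conv_rhs => rw [← fromBlocks_toBlocks B]
  rw [fromBlocks_multiply]
  simp only [toBlocks_fromBlocks₁₁, toBlocks_fromBlocks₁₂, toBlocks_fromBlocks₂₁, toBlocks_fromBlocks₂₂, Matrix.mul_zero,
    add_zero, zero_add, Matrix.mul_one]
  rw [← sub_eq_zero]
  have h : B.toBlocks₁₁ * A⁻¹ + B.toBlocks₁₂ - (B.toBlocks₂₁ * A⁻¹ + B.toBlocks₂₂) =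
      (B.toBlocks₁₁ - B.toBlocks₂₁) * A⁻¹ - (B.toBlocks₂₂ - B.toBlocks₁₂) := by
    rw [sub_mul]; abel
  rw [h, hBA, Matrix.mul_assoc, mul_nonsing_inv _ hAdet, Matrix.mul_one, sub_self]

/-- **THE MAIN ORBIT IN BLOCK FORM over a commutative ring with involution.**  For an isometry `B` of `J ⊕ −J` (`det J` a unit):
`B = P · ι(A, 1)` with `P` Siegel of unit `M(P)` and `A` `J`-unitary **iff** `M(B) = B₂₂ − B₁₂` is a unit.
[cite: GelbartPiatetskishapiroRallis1987, Part A §1] [cite: Liu2021, §B.3 (B.5), Lem. B.11] -/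
theorem exists_siegel_mul_iota_iff_isUnit_ring {J : Matrix ι ι R} (hJ : IsUnit J.det) (B : Matrix (ι ⊕ ι) (ι ⊕ ι) R)
    (hB : (B.map c)ᵀ * Matrix.fromBlocks J 0 0 (-J) * B = Matrix.fromBlocks J 0 0 (-J)) :
    (∃ (P : Matrix (ι ⊕ ι) (ι ⊕ ι) R) (A : Matrix ι ι R),
        P.toBlocks₁₁ + P.toBlocks₁₂ = P.toBlocks₂₁ + P.toBlocks₂₂ ∧ IsUnit (P.toBlocks₂₂ - P.toBlocks₁₂) ∧
          (A.map c)ᵀ * J * A = J ∧ B = P * fromBlocks A 0 0 1) ↔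
      IsUnit (B.toBlocks₂₂ - B.toBlocks₁₂) := by
  constructor
  · rintro ⟨P, A, _, hMP, _, rfl⟩
    exact isUnit_toBlocks_sub_siegel_mul_iota P hMP A
  · intro hM
    have hA := isUnit_mainOrbitBlock_ring c hJ B hB hM
    have hAdet : IsUnit ((B.toBlocks₂₂ - B.toBlocks₁₂)⁻¹ * (B.toBlocks₁₁ - B.toBlocks₂₁)).det := (isUnit_iff_isUnit_det _).1 hA
    refine ⟨B * fromBlocks ((B.toBlocks₂₂ - B.toBlocks₁₂)⁻¹ * (B.toBlocks₁₁ - B.toBlocks₂₁))⁻¹ 0 0 1,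
      (B.toBlocks₂₂ - B.toBlocks₁₂)⁻¹ * (B.toBlocks₁₁ - B.toBlocks₂₁),
      siegel_of_mainOrbit_block_ring B hA (sub_eq_toBlocks_sub_mul_mainOrbitBlock_ring B hM), ?_,
      unitary_mainOrbitBlock_ring c J B hB hM, ?_⟩
    · rw [toBlocks_sub_mul_fromBlocks_diag, Matrix.mul_one]; exact hM
    · rw [Matrix.mul_assoc, fromBlocks_multiply]
      simp only [Matrix.mul_zero, Matrix.zero_mul, add_zero, zero_add, Matrix.mul_one, nonsing_inv_mul _ hAdet, fromBlocks_one, Matrix.mul_one]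
where
  /-- `B₁₁ − B₂₁ = M(B)·A(B)` over a commutative ring. [folklore] -/
  sub_eq_toBlocks_sub_mul_mainOrbitBlock_ring (B : Matrix (ι ⊕ ι) (ι ⊕ ι) R) (hM : IsUnit (B.toBlocks₂₂ - B.toBlocks₁₂)) :
      B.toBlocks₁₁ - B.toBlocks₂₁ = (B.toBlocks₂₂ - B.toBlocks₁₂) * ((B.toBlocks₂₂ - B.toBlocks₁₂)⁻¹ * (B.toBlocks₁₁ - B.toBlocks₂₁)) := by
    rw [← Matrix.mul_assoc, mul_nonsing_inv _ ((isUnit_iff_isUnit_det _).1 hM), Matrix.one_mul]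

/-- **UNIQUENESS of `B = P · ι(A, 1)` over a commutative ring**: `P·ι(A,1) = P′·ι(A′,1)` with `P, P′` Siegel, `M(P)` a unit ⇒ `A = A′`, and
`P = P′` if `A` is a unit. [cite: GelbartPiatetskishapiroRallis1987, Part A §1] [cite: Liu2021, Lem. B.11] -/
theorem siegel_mul_iota_unique_ring {P P' : Matrix (ι ⊕ ι) (ι ⊕ ι) R} {A A' : Matrix ι ι R}
    (hP : P.toBlocks₁₁ + P.toBlocks₁₂ = P.toBlocks₂₁ + P.toBlocks₂₂) (hP' : P'.toBlocks₁₁ + P'.toBlocks₁₂ = P'.toBlocks₂₁ + P'.toBlocks₂₂)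
    (hMP : IsUnit (P.toBlocks₂₂ - P.toBlocks₁₂)) (h : P * fromBlocks A 0 0 1 = P' * fromBlocks A' 0 0 1) :
    A = A' ∧ (IsUnit A → P = P') := by
  have hcoord : ∀ (Q : Matrix (ι ⊕ ι) (ι ⊕ ι) R) (X : Matrix ι ι R), Q.toBlocks₁₁ + Q.toBlocks₁₂ = Q.toBlocks₂₁ + Q.toBlocks₂₂ →
      (Q * fromBlocks X 0 0 1).toBlocks₁₁ - (Q * fromBlocks X 0 0 1).toBlocks₂₁ = (Q.toBlocks₂₂ - Q.toBlocks₁₂) * X := by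
    intro Q X hQ
    have hQ' : Q.toBlocks₁₁ - Q.toBlocks₂₁ = Q.toBlocks₂₂ - Q.toBlocks₁₂ := by
      rw [sub_eq_sub_iff_add_eq_add, hQ, add_comm]
    conv_lhs => rw [← fromBlocks_toBlocks Q, fromBlocks_multiply]
    rw [toBlocks_fromBlocks₁₁, toBlocks_fromBlocks₂₁, Matrix.mul_zero, Matrix.mul_zero, add_zero, add_zero, ← sub_mul, hQ']
  have hM : (P * fromBlocks A 0 0 1).toBlocks₂₂ - (P * fromBlocks A 0 0 1).toBlocks₁₂ = P.toBlocks₂₂ - P.toBlocks₁₂ := by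
    rw [toBlocks_sub_mul_fromBlocks_diag, Matrix.mul_one]
  have hM' : (P' * fromBlocks A' 0 0 1).toBlocks₂₂ - (P' * fromBlocks A' 0 0 1).toBlocks₁₂ = P'.toBlocks₂₂ - P'.toBlocks₁₂ := by
    rw [toBlocks_sub_mul_fromBlocks_diag, Matrix.mul_one]
  have hMeq : P.toBlocks₂₂ - P.toBlocks₁₂ = P'.toBlocks₂₂ - P'.toBlocks₁₂ := by rw [← hM, h, hM']
  have h1 := hcoord P A hP
  have h2 := hcoord P' A' hP'
  rw [h, h2, ← hMeq] at h1
  have hMdet : IsUnit (P.toBlocks₂₂ - P.toBlocks₁₂).det := (isUnit_iff_isUnit_det _).1 hMP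
  have hAA : A = A' := by
    have := congrArg (fun X => (P.toBlocks₂₂ - P.toBlocks₁₂)⁻¹ * X) h1
    simpa only [← Matrix.mul_assoc, nonsing_inv_mul _ hMdet, Matrix.one_mul] using this.symm
  refine ⟨hAA, fun hA => ?_⟩
  subst hAA
  have hAdet : IsUnit A.det := (isUnit_iff_isUnit_det _).1 hA
  have hι : IsUnit (fromBlocks A 0 0 (1 : Matrix ι ι R)).det := by
    rw [det_fromBlocks_zero₂₁, det_one, mul_one]; exact hAdet
  have := congrArg (fun X => X * (fromBlocks A 0 0 (1 : Matrix ι ι R))⁻¹) h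
  simpa only [Matrix.mul_assoc, mul_nonsing_inv _ hι, Matrix.mul_one] using this

end Summit.HodgeConjecture.HodgeConjecture.Cruxes.HLiu418.K2LiuDoublingMainOrbitBlocksRing
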